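import Summits.BirchSwinnertonDyer.BirchSwinnertonDyer.Theorems.PublishedInputsGreenbergCasselsCokernelTorsionCount
import Summits.BirchSwinnertonDyer.Rank1Residual.X5.KummerRelaxedStrictCount
import Summits.BirchSwinnertonDyer.BirchSwinnertonDyer.Theorems.SchneiderFreeAdditiveX3PoitouTateReciprocitySumHolds
import Summits.BirchSwinnertonDyer.Rank1Residual.GaloisImage.LocalEulerPoincareCharacteristicHolds
import Literature.NumberTheory.EllipticCurves.LocalTorsionCohomologyCoprime
import Literature.NumberTheory.EllipticCurves.LocalKummerSequenceSurjective
import HarnessLib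

set_option linter.dupNamespace false -- `…BirchSwinnertonDyer.BirchSwinnertonDyer…` is the cell's nested layout (D-0017)
set_option autoImplicit false

/-!
# Greenberg LNM 1716 Lemma 4.7 WITH RATIONAL `p`-TORSION, part 5: CASSELS' COKERNEL AT ONE AUXILIARY PLACE, ANY PRIME `p`
# (`p = 2` included) — `#(H¹(Γ_{K_{v₀}}, E)(p) / loc_{v₀}(U)) ≤ #E(K)[p^∞]` (Prop. 4.13 read at `v₀`)

Cell `bsd-2adic` (run/shared/lean/pub/bsd-2adic/), seat `bsd-2adic-tower-1` GEN 31; `--supports stmt-BirchSwinnertonDyer-19271`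
(helper). THEOREMS ONLY (no definition, no named fact, no `sorry`); closes no item; nothing booked; BSD is not proved by any of this.

R. Greenberg, *Iwasawa theory for elliptic curves*, LNM 1716 (1999), §4 p. 104 and Appendix Prop. 4.13 (pp. 121–122): "a
theorem of Cassels which states that `𝒫_E^Σ(F)/𝒢_E^Σ(F) ≅ E(F)_p^∧`" (`= E(F)[p^∞]` when `Sel_E(F)_p` is finite). For `E = W`
elliptic over ANY number field `K`, ANY prime `p` (`p = 2` included), `Sel_{p^∞}(E/K)` finite, a finite `S` off which `E` has
good reduction and `v ∤ p`, and an auxiliary finite place `v₀ ∉ S`, in the currency of the Greenberg facts: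
**`C_{v₀} := H¹(Γ_{K_{v₀}}, E)(p) / (loc_{v₀}(U) ∩ ·)` is FINITE and `#C_{v₀} ≤ #E(K)[p^∞]`**, `U ≤ H¹(Γ_K, E[p^∞])` the classes
unramified outside `S ∪ {v₀}` with local class `0` on `S` and at `∞` — the hypothesis `hC` of part 4. Finite level (§1, every
`k ≥ 1`): `#loc_{v₀} H¹_{𝓛, ⊤ at v₀}(K, E[p^k]) = #𝓛_{v₀}` from the b2b-bsdres count
`X5.SelfDualCount.relIndex_kummerStrict_kummerRelaxed_singleton_eq` (Poitou–Tate WITH REAL PLACES and Tate's local Euler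
characteristic, tree theorems `poitouTate_selmerStructure_duality_real_holds`, `localEulerPoincareCharacteristic_holds`) —
replacing the `Odd p` port of seat k4-p1; hence (`#H¹(K_{v₀}, E)[p^k] = #E(K_{v₀})[p^k]`, `v₀ ∤ p`) the image of
`H¹_{𝓛, ⊤ at v₀}(K, E[p^k])` in `H¹(K_{v₀}, E)[p^k]` has index `#loc_{v₀} Sel_{p^k}(E/K) = #E(K)[p^∞]` at deep level (k4-p1,
`exists_map_localization_selmerGroup_eq_map_ker`, `natCard_map_localization_ker_torsionH1ToH1`, any `p`). Passage to `p^∞`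
(§2–§3): the dictionary `x ↦ res_⊤ ι_* x` (`SignedEC.CasselsPT`) sends `H¹_{𝓛, ⊤ at v₀}(K, E[p^k])` into `U` with
`loc_{v₀}(res_⊤ ι_* x) = res(κ_{v₀} loc_{v₀} x)`; every finite subset of `C_{v₀}` lifts to one deep level `p^k`.

* §1 `natCard_map_kummerOutside_eq`, `exists_natCard_map_localization_selmerGroup_eq`, `natCard_torsionBy_localH1_eq_mul`;
* §2 `res_torsionPowToPrimaryH1_mem_of_mem_kummerOutside`; §3 **`finite_and_natCard_cokernel_le`** — the count.

HONEST FRAMING: kernel-checked over tree theorems (b2b-bsdres X5/X11b, k4-p1, bsd-schneider PT); closes no item; no summit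
statement is proved; the Birch–Swinnerton-Dyer conjecture is NOT proved by any of this.

References: [GreenbergLNM1716] §4 p. 104, Prop. 4.13 (pp. 121–122); [MilneADT2006] I Thm. 2.8, Cor. 3.4, Lemma 3.3, Thm. 4.10,
Lemma 6.15; [Howard2004HeegnerKolyvagin] Thm. 2.1.11.
-/

noncomputable section

open scoped Classical NumberField

open NumberField IsDedekindDomain Field Function

namespace Summit.BirchSwinnertonDyer.BirchSwinnertonDyer.Theorems.TorsionEulerChar

open Literature.NumberTheory.EllipticCurves Literature.NumberTheory.GaloisRepresentations
  WeierstrassCurve Literature.NumberTheory.GaloisCohomology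
  Literature.NumberTheory.EllipticCurves.GreenbergVatsal2000 Literature.NumberTheory.EllipticCurves.GreenbergSelmer
open Literature.NumberTheory.GaloisRepresentations.DiscreteGaloisModule (SelmerStructure unramifiedSubgroup)

variable {K : Type} [Field K] [NumberField K] (W : WeierstrassCurve K) [W.IsElliptic] (p : ℕ) [hp : Fact p.Prime]

/-! ## §1 Finite level `p^k`: the counts at one finite place -/

section FiniteLevel

/-- **`#loc_𝔮 H¹_{𝓛, ⊤ at 𝔮}(K, E[p^k]) = #𝓛_𝔮 (= #E(K_𝔮)[p^k] · #(𝓞_𝔮/p^k))`** for every number field `K`, EVERY prime `p`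
(`p = 2` included), `k ≥ 1` and every finite place `𝔮`: the kernel of `loc_𝔮` on the relaxed group `kummerOutside W (p^k) {𝔮}`
is the strict group `H¹_{𝓛, ⊥ at 𝔮}`, whose index is the b2b-bsdres count
`X5.SelfDualCount.relIndex_kummerStrict_kummerRelaxed_singleton_eq` (Poitou–Tate with real places and Tate's local Euler
characteristic, both tree theorems). [cite: MilneADT2006, Ch. I, Thm. 2.8, Thm. 4.10 and Lemma 6.15]
[cite: Howard2004HeegnerKolyvagin, Thm. 2.1.11 (arXiv:1202.6340 p. 6)] -/
theorem natCard_map_kummerOutside_eq (k : ℕ) (hk : 0 < k) (𝔮 : HeightOneSpectrum (𝓞 K)) :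
    Nat.card ((kummerOutside W (p ^ k) {Sum.inr 𝔮}).map
        (galoisCohomology.localization (W.torsionGaloisModule ((p ^ k : ℕ) : ℤ)) (Sum.inr 𝔮) 1)) =
      Nat.card (W.kummerSelmerStructure ((p ^ k : ℕ) : ℤ) (Sum.inr 𝔮)) := by
  have hprime : p.Prime := hp.out
  haveI : NeZero (p ^ k) := ⟨pow_ne_zero k hprime.ne_zero⟩
  have hpp : IsPrimePow (p ^ k) := ⟨p, k, hprime.prime, hk, rfl⟩
  obtain ⟨inv, hperf, hvan, -, hcomp, hreal⟩ :=
    SchneiderFreeAdditiveX3.PoitouTateReduction.poitouTate_selmerStructure_duality_real_holds K (p ^ k)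
  have hEP : ∀ v : HeightOneSpectrum (𝓞 K), localEulerPoincareCharacteristic (v.adicCompletion K) := fun v ↦ by
    haveI : CharZero (v.adicCompletion K) := charZero_of_injective_algebraMap (algebraMap K _).injective
    exact localEulerPoincareCharacteristic_holds (v.adicCompletion K)
  have hX5 := Summit.BirchSwinnertonDyer.Rank1Residual.X5.SelfDualCount.relIndex_kummerStrict_kummerRelaxed_singleton_eq
    W (p ^ k) hpp inv hperf hvan hcomp hEP hreal 𝔮
  rw [Summit.BirchSwinnertonDyer.Rank1Residual.X11b.KummerPT.selmerGroup_kummerRelaxed,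
    ← W.natCard_kummerSelmerStructure_inr 𝔮 (NeZero.ne (p ^ k))] at hX5
  rw [← hX5, AddSubgroup.relIndex]
  set loc := galoisCohomology.localization (W.torsionGaloisModule ((p ^ k : ℕ) : ℤ)) (Sum.inr 𝔮) 1 with hloc
  set KO := kummerOutside W (p ^ k) {Sum.inr 𝔮} with hKO
  -- the strict group inside the relaxed one is the kernel of `loc_𝔮`
  have hker : (Summit.BirchSwinnertonDyer.Rank1Residual.X11b.KummerPT.kummerStrict W (p ^ k)
        {(Sum.inr 𝔮 : Place K)}).selmerGroup.addSubgroupOf KO = (loc.comp KO.subtype).ker := by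
    ext c
    obtain ⟨c, hc⟩ := c
    rw [AddSubgroup.mem_addSubgroupOf, AddMonoidHom.mem_ker, SelmerStructure.mem_selmerGroup_iff]
    constructor
    · intro h
      have h𝔮 := h (Sum.inr 𝔮)
      rw [Summit.BirchSwinnertonDyer.Rank1Residual.X11b.KummerPT.kummerStrict_of_mem W (p ^ k) _
        (Finset.mem_singleton_self _), AddSubgroup.mem_bot] at h𝔮
      exact h𝔮
    · intro h v
      by_cases hv : v ∈ ({(Sum.inr 𝔮 : Place K)} : Finset (Place K))
      · rw [Finset.mem_singleton] at hv; subst hv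
        rw [Summit.BirchSwinnertonDyer.Rank1Residual.X11b.KummerPT.kummerStrict_of_mem W (p ^ k) _
          (Finset.mem_singleton_self _), AddSubgroup.mem_bot]
        exact h
      · rw [Summit.BirchSwinnertonDyer.Rank1Residual.X11b.KummerPT.kummerStrict_of_not_mem W (p ^ k) _ hv]
        exact (mem_kummerOutside_iff W (p ^ k) _ c).mp hc v hv
  rw [hker, AddSubgroup.index_ker, AddMonoidHom.range_comp, AddSubgroup.range_subtype]

/-- **`#loc_𝔮 Sel_{p^k}(E/K) = #E(K)[p^∞]` at deep level** (`𝔮 ∤ p`, `Sel_{p^∞}(E/K)` finite, rational `p`-torsion allowed, any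
`p`): k4-p1's `loc_𝔮 Sel_N = loc_𝔮 κ_N(E(K))` (`exists_map_localization_selmerGroup_eq_map_ker`) and
`#loc_𝔮 κ_N(E(K)) = #E(K)(p)` (`natCard_map_localization_ker_torsionH1ToH1`). [cite: GreenbergLNM1716, §4 Appendix Prop. 4.13 (p. 122)] -/
theorem exists_natCard_map_localization_selmerGroup_eq [Finite (W.selmerGroupPInfty p)] (𝔮 : HeightOneSpectrum (𝓞 K))
    (h𝔮 : ((p : ℕ) : 𝓞 K) ∉ 𝔮.asIdeal) :
    ∃ k₁ : ℕ, ∀ k : ℕ, k₁ ≤ k →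
      Nat.card ((W.selmerGroup ((p ^ k : ℕ) : ℤ)).map
          (galoisCohomology.localization (W.torsionGaloisModule ((p ^ k : ℕ) : ℤ)) (Sum.inr 𝔮) 1)) =
        Nat.card (AddCommGroup.primaryComponent W.toAffine.Point p) := by
  haveI : Finite W.toAffine.Point := W.finite_point_of_finite_selmerGroupPInfty p
  obtain ⟨e, a, hE2⟩ := InputsGreenbergCasselsTorsion.exists_map_localization_selmerGroup_eq_map_ker W p 𝔮 h𝔮
  obtain ⟨a', -, ha'⟩ := InputsGreenbergCasselsTorsion.exists_pow_divisible_point_adicCompletion W p 𝔮 h𝔮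
  refine ⟨e + a + a' + 1, fun k hk ↦ ?_⟩
  have hlev : ((p ^ k : ℕ) : ℤ) = ((p ^ e : ℕ) : ℤ) * ((p ^ (k - e) : ℕ) : ℤ) := by
    rw [← Nat.cast_mul, ← pow_add, show e + (k - e) = k by omega]
  rw [InputsGreenbergCasselsTorsion.natCard_map_localization_selmerGroup_congr W 𝔮 hlev, hE2 (k - e) (by omega)]
  exact InputsGreenbergCasselsTorsion.natCard_map_localization_ker_torsionH1ToH1 W p 𝔮 a' ha' k (by omega) hlev.symm

/-- **The finite-level cokernel count: `#H¹(K_𝔮, E)[p^k] = #κ_𝔮(loc_𝔮 H¹_{𝓛, ⊤ at 𝔮}(K, E[p^k])) · #loc_𝔮 Sel_{p^k}(E/K)`**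
(`𝔮 ∤ p`, `k ≥ 1`, any prime `p`): the image of the relaxed group in `H¹(K_𝔮, E)[p^k] = H¹(K_𝔮, E[p^k])/𝓛_𝔮` has index
`#loc_𝔮 Sel_{p^k}` — from `#loc_𝔮 H¹_{𝓛, ⊤ at 𝔮} = #𝓛_𝔮 = #E(K_𝔮)[p^k] = #H¹(K_𝔮, E)[p^k]` (previous theorem, Milne I Lemma 3.3,
Tate local duality `natCard_torsionBy_galoisCohomology_localGaloisModule_eq_of_not_mem`) and
`loc_𝔮 Sel = loc_𝔮 H¹_{𝓛, ⊤ at 𝔮} ∩ 𝓛_𝔮 = loc_𝔮 H¹_{𝓛, ⊤ at 𝔮} ∩ ker κ_𝔮`. [cite: GreenbergLNM1716, §4 Appendix Prop. 4.13 (pp. 121–122)]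
[cite: MilneADT2006, Ch. I, Cor. 3.4 and Lemma 6.15] -/
theorem natCard_torsionBy_localH1_eq_mul (k : ℕ) (hk : 0 < k) (𝔮 : HeightOneSpectrum (𝓞 K))
    (h𝔮 : ((p : ℕ) : 𝓞 K) ∉ 𝔮.asIdeal) :
    Nat.card (AddSubgroup.torsionBy (galoisCohomology (W.localGaloisModule (𝔮.adicCompletion K)) 1)
        ((p ^ k : ℕ) : ℤ)) =
      Nat.card (((kummerOutside W (p ^ k) {Sum.inr 𝔮}).map
            (galoisCohomology.localization (W.torsionGaloisModule ((p ^ k : ℕ) : ℤ)) (Sum.inr 𝔮) 1)).map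
          (galoisCohomology.map (W.torsionPointsMapIntertwining ((p ^ k : ℕ) : ℤ) (𝔮.adicCompletion K)) 1)) *
        Nat.card ((W.selmerGroup ((p ^ k : ℕ) : ℤ)).map
          (galoisCohomology.localization (W.torsionGaloisModule ((p ^ k : ℕ) : ℤ)) (Sum.inr 𝔮) 1)) := by
  have hprime : p.Prime := hp.out
  haveI : NeZero (p ^ k) := ⟨pow_ne_zero k hprime.ne_zero⟩
  have h𝔮k : ((p ^ k : ℕ) : 𝓞 K) ∉ 𝔮.asIdeal := by
    rw [Nat.cast_pow]
    exact fun h ↦ h𝔮 (𝔮.isPrime.mem_of_pow_mem k h)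
  set loc := galoisCohomology.localization (W.torsionGaloisModule ((p ^ k : ℕ) : ℤ)) (Sum.inr 𝔮) 1 with hloc
  set G := (kummerOutside W (p ^ k) {Sum.inr 𝔮}).map loc with hG
  set κq := galoisCohomology.map (W.torsionPointsMapIntertwining ((p ^ k : ℕ) : ℤ) (𝔮.adicCompletion K)) 1
    with hκq
  set L := W.kummerSelmerStructure ((p ^ k : ℕ) : ℤ) (Sum.inr 𝔮) with hL
  -- `#H¹(K_𝔮, E)[p^k] = #E(K_𝔮)[p^k] = #𝓛_𝔮 = #G`
  have h1 : Nat.card (AddSubgroup.torsionBy (galoisCohomology (W.localGaloisModule (𝔮.adicCompletion K)) 1)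
      ((p ^ k : ℕ) : ℤ)) = Nat.card L := by
    rw [natCard_torsionBy_galoisCohomology_localGaloisModule_eq_of_not_mem W 𝔮 (p ^ k) h𝔮k, hL,
      W.natCard_kummerSelmerStructure_inr 𝔮 (NeZero.ne (p ^ k)),
      InputsGreenbergCasselsTorsion.natCard_quot_adicCompletionIntegers_eq_one p 𝔮 h𝔮 k, mul_one]
  have h2 : Nat.card G = Nat.card L := natCard_map_kummerOutside_eq W p k hk 𝔮
  -- `κ_𝔮|_G` has kernel `G ∩ 𝓛_𝔮 = loc_𝔮 Sel`
  have hker : (κq.comp G.subtype).ker = (G ⊓ L).addSubgroupOf G := by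
    rw [AddSubgroup.inf_addSubgroupOf_left]
    ext y
    obtain ⟨y, hy⟩ := y
    rw [AddMonoidHom.mem_ker, AddSubgroup.mem_addSubgroupOf]
    exact Iff.rfl
  have hrange : (κq.comp G.subtype).range = G.map κq := by
    ext y
    constructor
    · rintro ⟨⟨g, hg⟩, rfl⟩; exact ⟨g, hg, rfl⟩
    · rintro ⟨g, hg, rfl⟩; exact ⟨⟨g, hg⟩, rfl⟩
  have h3 : Nat.card G = Nat.card (G.map κq) * Nat.card ((W.selmerGroup ((p ^ k : ℕ) : ℤ)).map loc) := by
    have hidx := AddSubgroup.card_mul_index (κq.comp G.subtype).ker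
    rw [AddSubgroup.index_ker, hrange] at hidx
    rw [← hidx, hker, Nat.card_congr (AddSubgroup.addSubgroupOfEquivOfLe (inf_le_left : G ⊓ L ≤ G)).toEquiv,
      ← Summit.BirchSwinnertonDyer.Rank1Residual.X11b.KummerPT.map_selmerGroup_eq_inf W p k 𝔮, mul_comm]
  rw [h1, ← h2, h3]

end FiniteLevel

/-! ## §2 The dictionary lands in `U` -/

section Dictionary

/-- **`res_⊤ ι_* x ∈ U` for `x ∈ H¹_{𝓛, ⊤ at v₀}(K, E[p^k])`**: the class is unramified outside `S ∪ {v₀}` (at a good `v ∤ p`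
off `S ∪ {v₀}` the Kummer condition is `H¹_ur`, `kummerSelmerStructure_inr_eq_unramifiedSubgroup`, and
`res_torsionPowToPrimaryH1_mem_unramifiedKer`) and its local class vanishes on `S` and at `∞` (there `loc_v x ∈ 𝓛_v = ker κ_v`
and `localResOver_top_res_torsionPowToPrimaryH1`). [cite: GreenbergLNM1716, §2 pp. 62–63, §4 Appendix p. 122]
[cite: GreenbergVatsal2000, §2 p. 17] -/
theorem res_torsionPowToPrimaryH1_mem_of_mem_kummerOutside (k : ℕ) (S : Finset (HeightOneSpectrum (𝓞 K)))
    (hS : ∀ v ∉ S, ((p : ℕ) : 𝓞 K) ∉ v.asIdeal ∧ W.HasGoodReductionAt v)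
    (v₀ : HeightOneSpectrum (𝓞 K)) (hv₀ : v₀ ∉ S)
    (x : galH1Torsion W ((p ^ k : ℕ) : ℤ)) (hx : x ∈ kummerOutside W (p ^ k) {Sum.inr v₀}) :
    resH1Hom (Literature.NumberTheory.EllipticCurves.subgroupIncl (⊤ : Subgroup (absoluteGaloisGroup K)))
        (AddMonoidHom.id (geomPrimaryTorsion W p)) (fun _ _ ↦ rfl) (torsionPowToPrimaryH1 W p k x) ∈
      unramifiedOutside (⊤ : Subgroup (absoluteGaloisGroup K)) (W.geomPrimaryTorsion p) p
          ((↑S : Set (HeightOneSpectrum (𝓞 K))) ∪ {v₀}) ⊓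
        (⨅ v ∈ S, W.localKerOver p ⊤ (v.adicCompletion K)) ⊓
        (⨅ w : InfinitePlace K, W.localKerOver p ⊤ w.Completion) := by
  have hout := (mem_kummerOutside_iff W (p ^ k) {Sum.inr v₀} x).mp hx
  refine AddSubgroup.mem_inf.mpr ⟨AddSubgroup.mem_inf.mpr ⟨?_, ?_⟩, ?_⟩
  · -- unramified outside `S ∪ {v₀}`
    rw [GreenbergVatsal2000.mem_unramifiedOutside_iff]
    intro v hvS hvp σ
    rw [show Literature.NumberTheory.EllipticCurves.conjH1 ⊤ (W.geomPrimaryTorsion p) σ = AddMonoidHom.id _ from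
      W.conjH1_of_mem_holds p ⊤ (Subgroup.mem_top σ), AddMonoidHom.id_apply]
    apply SignedEC.CasselsPT.res_torsionPowToPrimaryH1_mem_unramifiedKer W p k x
    have hvS' : v ∉ S := fun h ↦ hvS (Set.mem_union_left _ (Finset.mem_coe.mpr h))
    have hvne : v ≠ v₀ := fun h ↦ hvS (Set.mem_union_right _ (Set.mem_singleton_iff.mpr h))
    have hmem := hout (Sum.inr v) (fun h ↦ hvne (Sum.inr_injective (Finset.mem_singleton.mp h)))
    rw [← Summit.BirchSwinnertonDyer.Rank1Residual.X11b.KummerPT.kummerSelmerStructure_inr_eq_unramifiedSubgroup W p k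
      hvp (hS v hvS').2]
    exact hmem
  · -- local class `0` on `S`
    refine AddSubgroup.mem_iInf.mpr fun v ↦ AddSubgroup.mem_iInf.mpr fun hv ↦ ?_
    have hvne : v ≠ v₀ := fun h ↦ hv₀ (h ▸ hv)
    have hmem := hout (Sum.inr v) (fun h ↦ hvne (Sum.inr_injective (Finset.mem_singleton.mp h)))
    rw [W.mem_localKerOver_iff, SignedEC.CasselsPT.localResOver_top_res_torsionPowToPrimaryH1 W p k
      (v.adicCompletion K) x]
    have h0 : galoisCohomology.map (W.torsionPointsMapIntertwining ((p ^ k : ℕ) : ℤ) (v.adicCompletion K)) 1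
        (galoisCohomology.res (W.torsionGaloisModule ((p ^ k : ℕ) : ℤ)) (v.adicCompletion K) 1 x) = 0 := hmem
    rw [h0]; exact map_zero _
  · -- local class `0` at the infinite places
    refine AddSubgroup.mem_iInf.mpr fun w ↦ ?_
    have hmem := hout (Sum.inl w) (fun h ↦ Sum.inl_ne_inr (Finset.mem_singleton.mp h))
    rw [W.mem_localKerOver_iff, SignedEC.CasselsPT.localResOver_top_res_torsionPowToPrimaryH1 W p k w.Completion x]
    have h0 : galoisCohomology.map (W.torsionPointsMapIntertwining ((p ^ k : ℕ) : ℤ) w.Completion) 1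
        (galoisCohomology.res (W.torsionGaloisModule ((p ^ k : ℕ) : ℤ)) w.Completion 1 x) = 0 := hmem
    rw [h0]; exact map_zero _

end Dictionary

/-! ## §3 The count at `p^∞` -/

section Count

/-- **CASSELS' COKERNEL AT ONE AUXILIARY PLACE, ANY PRIME `p` (Greenberg Prop. 4.13 read at `v₀`).** For `E = W` elliptic over a
number field `K`, a prime `p`, `Sel_{p^∞}(E/K)` finite, a finite `S` off which `E` has good reduction and `v ∤ p`, and `v₀ ∉ S`:
with `P₀ = H¹(Γ_{K_{v₀}}, E)(p)` (the `p`-primary part of `discreteH1 (localSubgroup ⊤ K_{v₀}) (localPoints W K_{v₀})`) and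
`L = loc_{v₀}(U)`, `U ≤ H¹(Γ_K, E[p^∞])` the classes unramified outside `S ∪ {v₀}` with local class `0` on `S` and at `∞`,
**the quotient `P₀ / (L ∩ P₀)` is finite of order `≤ #E(K)[p^∞]`** (rational `p`-torsion allowed, `p = 2` allowed). Proof: a
finite subset of the quotient lifts to classes killed by one `p^k` (`k` deep), i.e. (bijective restriction,
`SignedEC.CasselsPT.exists_preimage_localSubgroup_top`) to `H¹(K_{v₀}, E)[p^k]`, whose subgroup `κ_{v₀} loc_{v₀} H¹_{𝓛, ⊤ at v₀}`
of index `#loc_{v₀} Sel_{p^k} = #E(K)[p^∞]` (§1) maps into `L` (§2).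
[cite: GreenbergLNM1716, §4 p. 104 and Appendix Prop. 4.13 (pp. 121–122)] [cite: MilneADT2006, Ch. I, Thm. 4.10 and Lemma 6.15] -/
theorem finite_and_natCard_cokernel_le [Finite (W.selmerGroupPInfty p)] (S : Finset (HeightOneSpectrum (𝓞 K)))
    (hS : ∀ v ∉ S, ((p : ℕ) : 𝓞 K) ∉ v.asIdeal ∧ W.HasGoodReductionAt v)
    (v₀ : HeightOneSpectrum (𝓞 K)) (hv₀ : v₀ ∉ S) :
    Finite (AddCommGroup.primaryComponent
          (discreteH1 (localSubgroup (⊤ : Subgroup (absoluteGaloisGroup K)) (v₀.adicCompletion K))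
            (localPoints W (v₀.adicCompletion K))) p ⧸
        (AddSubgroup.map (W.localResOver p ⊤ (v₀.adicCompletion K))
          (unramifiedOutside (⊤ : Subgroup (absoluteGaloisGroup K)) (W.geomPrimaryTorsion p) p
              ((↑S : Set (HeightOneSpectrum (𝓞 K))) ∪ {v₀}) ⊓
            (⨅ v ∈ S, W.localKerOver p ⊤ (v.adicCompletion K)) ⊓
            (⨅ w : InfinitePlace K, W.localKerOver p ⊤ w.Completion))).addSubgroupOf
          (AddCommGroup.primaryComponent
            (discreteH1 (localSubgroup (⊤ : Subgroup (absoluteGaloisGroup K)) (v₀.adicCompletion K))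
              (localPoints W (v₀.adicCompletion K))) p)) ∧
      Nat.card (AddCommGroup.primaryComponent
          (discreteH1 (localSubgroup (⊤ : Subgroup (absoluteGaloisGroup K)) (v₀.adicCompletion K))
            (localPoints W (v₀.adicCompletion K))) p ⧸
        (AddSubgroup.map (W.localResOver p ⊤ (v₀.adicCompletion K))
          (unramifiedOutside (⊤ : Subgroup (absoluteGaloisGroup K)) (W.geomPrimaryTorsion p) p
              ((↑S : Set (HeightOneSpectrum (𝓞 K))) ∪ {v₀}) ⊓
            (⨅ v ∈ S, W.localKerOver p ⊤ (v.adicCompletion K)) ⊓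
            (⨅ w : InfinitePlace K, W.localKerOver p ⊤ w.Completion))).addSubgroupOf
          (AddCommGroup.primaryComponent
            (discreteH1 (localSubgroup (⊤ : Subgroup (absoluteGaloisGroup K)) (v₀.adicCompletion K))
              (localPoints W (v₀.adicCompletion K))) p)) ≤
        Nat.card (AddCommGroup.primaryComponent W.toAffine.Point p) := by
  classical
  -- notation
  let Pv := discreteH1 (localSubgroup (⊤ : Subgroup (absoluteGaloisGroup K)) (v₀.adicCompletion K))
    (localPoints W (v₀.adicCompletion K))
  let P₀ : AddSubgroup Pv := AddCommGroup.primaryComponent Pv p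
  let U : AddSubgroup (W.subgroupH1 p (⊤ : Subgroup (absoluteGaloisGroup K))) :=
    unramifiedOutside (⊤ : Subgroup (absoluteGaloisGroup K)) (W.geomPrimaryTorsion p) p
        ((↑S : Set (HeightOneSpectrum (𝓞 K))) ∪ {v₀}) ⊓
      (⨅ v ∈ S, W.localKerOver p ⊤ (v.adicCompletion K)) ⊓
      (⨅ w : InfinitePlace K, W.localKerOver p ⊤ w.Completion)
  let L : AddSubgroup Pv := U.map (W.localResOver p ⊤ (v₀.adicCompletion K))
  let C := P₀ ⧸ L.addSubgroupOf P₀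
  change Finite C ∧ Nat.card C ≤ _
  have hprime : p.Prime := hp.out
  have hp₀ : ((p : ℕ) : 𝓞 K) ∉ v₀.asIdeal := (hS v₀ hv₀).1
  set B := Nat.card (AddCommGroup.primaryComponent W.toAffine.Point p) with hB
  obtain ⟨k₁, hk₁⟩ := exists_natCard_map_localization_selmerGroup_eq W p v₀ hp₀
  -- the ambient local group `A = H¹(Γ_{K_{v₀}}, E)` and the (bijective) restriction `ρ : A → Pv`
  let A := galoisCohomology (W.localGaloisModule (v₀.adicCompletion K)) 1
  let ρ : A →+ Pv := resH1Hom (Literature.NumberTheory.EllipticCurves.subgroupIncl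
      (localSubgroup (⊤ : Subgroup (absoluteGaloisGroup K)) (v₀.adicCompletion K)))
    (AddMonoidHom.id (localPoints W (v₀.adicCompletion K))) (fun _ _ ↦ rfl)
  -- STEP A: at each level `p^k`, the map `φ_k : A[p^k] → C`, `a ↦ [ρ a]`, and its range
  have stepA : ∀ k : ℕ, 0 < k → k₁ ≤ k →
      ∃ φ : AddSubgroup.torsionBy A ((p ^ k : ℕ) : ℤ) →+ C,
        (∀ (a : AddSubgroup.torsionBy A ((p ^ k : ℕ) : ℤ)) (z : P₀), (z : Pv) = ρ a →
          φ a = QuotientAddGroup.mk z) ∧ Finite φ.range ∧ Nat.card φ.range ≤ B := by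
    intro k hk hkk
    haveI : NeZero (p ^ k) := ⟨pow_ne_zero k hprime.ne_zero⟩
    set H := AddSubgroup.torsionBy A ((p ^ k : ℕ) : ℤ) with hH
    -- `ρ(H) ⊆ P₀`
    have hmemP : ∀ a : H, ρ a ∈ P₀ := fun a ↦ by
      have ha : p ^ k • (a : A) = 0 := AddSubgroup.torsionBy.nsmul_iff.mp a.2
      exact (AddCommGroup.mem_primaryComponent).mpr ⟨k, by rw [← map_nsmul, ha, map_zero]⟩
    let ψ : H →+ P₀ := (ρ.comp H.subtype).codRestrict P₀ fun a ↦ hmemP a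
    let φ : H →+ C := (QuotientAddGroup.mk' (L.addSubgroupOf P₀)).comp ψ
    have hφ : ∀ (a : H) (z : P₀), (z : Pv) = ρ a → φ a = QuotientAddGroup.mk z := by
      intro a z hz
      have hψ : ψ a = z := Subtype.ext hz.symm
      change QuotientAddGroup.mk' (L.addSubgroupOf P₀) (ψ a) = _
      rw [hψ, QuotientAddGroup.mk'_apply]
    -- `H` is finite (`#H = #E(K_{v₀})[p^k] ≠ 0`)
    have hcard := natCard_torsionBy_localH1_eq_mul W p k hk v₀ hp₀
    haveI hHfin : Finite H := by
      refine Nat.finite_of_card_ne_zero ?_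
      rw [hH, natCard_torsionBy_galoisCohomology_localGaloisModule_eq_of_not_mem W v₀ (p ^ k)
        (by rw [Nat.cast_pow]; exact fun h ↦ hp₀ (v₀.isPrime.mem_of_pow_mem k h))]
      haveI := W.finite_ker_nsmul_adicCompletion v₀ (NeZero.ne (p ^ k))
      exact Nat.card_pos.ne'
    haveI hRfin : Finite φ.range := Finite.of_surjective φ.rangeRestrict φ.rangeRestrict_surjective
    refine ⟨φ, hφ, hRfin, ?_⟩
    -- the image `G' = κ loc H¹_{𝓛, ⊤ at v₀}` of the relaxed group lies in `ker φ`
    set loc := galoisCohomology.localization (W.torsionGaloisModule ((p ^ k : ℕ) : ℤ)) (Sum.inr v₀) 1 with hloc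
    set κq := galoisCohomology.map (W.torsionPointsMapIntertwining ((p ^ k : ℕ) : ℤ) (v₀.adicCompletion K)) 1
      with hκq
    set G' := ((kummerOutside W (p ^ k) {Sum.inr v₀}).map loc).map κq with hG'
    have hG'H : G' ≤ H := by
      rintro _ ⟨y, -, rfl⟩
      refine AddSubgroup.torsionBy.nsmul_iff.mpr ?_
      rw [← natCast_zsmul]
      exact W.zsmul_map_torsionPointsMapIntertwining (v₀.adicCompletion K) y
    have hG'ker : G'.addSubgroupOf H ≤ φ.ker := by
      intro a ha
      rw [AddSubgroup.mem_addSubgroupOf, hG'] at ha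
      obtain ⟨y, ⟨x, hx, rfl⟩, hy⟩ := ha
      rw [AddMonoidHom.mem_ker, hφ a (ψ a) rfl, QuotientAddGroup.eq_zero_iff, AddSubgroup.mem_addSubgroupOf]
      refine ⟨_, res_torsionPowToPrimaryH1_mem_of_mem_kummerOutside W p k S hS v₀ hv₀ x hx, ?_⟩
      rw [SignedEC.CasselsPT.localResOver_top_res_torsionPowToPrimaryH1 W p k (v₀.adicCompletion K) x]
      change ρ (κq (loc x)) = ρ (a : A)
      rw [hy]
    -- index count: `#range φ = [H : ker φ] ≤ [H : G'] = #loc Sel_{p^k} = B`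
    have hidx : (G'.addSubgroupOf H).index = Nat.card ((W.selmerGroup ((p ^ k : ℕ) : ℤ)).map loc) := by
      have h1 := AddSubgroup.card_mul_index (G'.addSubgroupOf H)
      rw [Nat.card_congr (AddSubgroup.addSubgroupOfEquivOfLe hG'H).toEquiv, hcard] at h1
      haveI : Finite G' := Finite.of_injective _ (AddSubgroup.inclusion_injective hG'H)
      exact Nat.eq_of_mul_eq_mul_left (Nat.card_pos (α := G')) h1
    calc Nat.card φ.range = φ.ker.index := (AddSubgroup.index_ker φ).symm
      _ ≤ (G'.addSubgroupOf H).index := Nat.le_of_dvd (Nat.pos_of_ne_zero (AddSubgroup.index_ne_zero_of_finite))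
          (AddSubgroup.index_dvd_of_le hG'ker)
      _ = B := by rw [hidx, hk₁ k hkk]
  -- STEP B: every finite subset of `C` has at most `B` elements
  have stepB : ∀ T : Finset C, T.card ≤ B := by
    intro T
    -- representatives and a common deep level
    have hrep : ∀ c : C, ∃ z : P₀, QuotientAddGroup.mk z = c := QuotientAddGroup.mk_surjective
    choose rep hrep using hrep
    have hexp : ∀ c : C, ∃ n : ℕ, p ^ n • ((rep c : P₀) : Pv) = 0 := fun c ↦
      (AddCommGroup.mem_primaryComponent).mp (rep c).2
    choose n hn using hexp
    set k := max (max k₁ 1) (T.sup n) with hkdef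
    have hk0 : 0 < k := lt_of_lt_of_le (lt_of_lt_of_le Nat.one_pos (le_max_right _ _)) (le_max_left _ _)
    have hkk : k₁ ≤ k := (le_max_left _ _).trans (le_max_left _ _)
    obtain ⟨φ, hφ, hfin, hle⟩ := stepA k hk0 hkk
    haveI := hfin
    -- every `t ∈ T` is in the range of `φ`
    have hT : ∀ t ∈ T, (t : C) ∈ φ.range := by
      intro t ht
      have hnt : n t ≤ k := (Finset.le_sup ht).trans (le_max_right _ _)
      have hkill : p ^ k • ((rep t : P₀) : Pv) = 0 := by
        obtain ⟨d, hd⟩ := Nat.exists_eq_add_of_le hnt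
        rw [hd, pow_add, mul_comm, mul_smul, hn t, smul_zero]
      obtain ⟨a, ha, hak⟩ : ∃ a : A, ρ a = ((rep t : P₀) : Pv) ∧ p ^ k • a = 0 :=
        SignedEC.CasselsPT.exists_preimage_localSubgroup_top W p (v₀.adicCompletion K) k ((rep t : P₀) : Pv) hkill
      have haH : a ∈ AddSubgroup.torsionBy A ((p ^ k : ℕ) : ℤ) := AddSubgroup.torsionBy.nsmul_iff.mpr hak
      exact ⟨⟨a, haH⟩, by rw [hφ ⟨a, haH⟩ (rep t) ha.symm, hrep t]⟩
    -- inject `T` into `range φ`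
    have hinj : Function.Injective (fun t : T ↦ (⟨(t : C), hT t t.2⟩ : φ.range)) := fun t₁ t₂ h ↦
      Subtype.ext (congrArg (fun r : φ.range ↦ (r : C)) h)
    have h := Nat.card_le_card_of_injective _ hinj
    rw [Nat.card_eq_fintype_card, Fintype.card_coe] at h
    exact h.trans hle
  -- conclusion
  have hfinC : Finite C := by
    by_contra hinf
    haveI : Infinite C := not_finite_iff_infinite.mp hinf
    obtain ⟨T, hT⟩ := Infinite.exists_subset_card_eq C (B + 1)
    have := stepB T
    omega
  refine ⟨hfinC, ?_⟩
  haveI := Fintype.ofFinite C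
  have h := stepB Finset.univ
  rwa [Finset.card_univ, ← Nat.card_eq_fintype_card] at h

end Count

end Summit.BirchSwinnertonDyer.BirchSwinnertonDyer.Theorems.TorsionEulerChar

end
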